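import Summits.BirchSwinnertonDyer.Rank1Residual.Additive.ChiBranchRatLowerDvdOddEnds
import Summits.BirchSwinnertonDyer.Rank1Residual.Additive.ChiBranchRatLowerDvdMultOdd
import Summits.BirchSwinnertonDyer.Rank1Residual.Additive.ChiBranchRatLowerDvd
import Summits.BirchSwinnertonDyer.Rank1Residual.Additive.CensusQ6UnitCoeffCertificate
import HarnessLib

/-!
# Q6 certificate RECORDS (`CensusQ6.*FirstUnitIndexAt`, census-ctyper1) as the certificate binder of
# the phase-4 ends: Stage A PASS row + the one-sided rational containment on the branch ⟹ `BSD(E,p)`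
# (cell `b2b-bsdres`, team n1011, seat n1011-p06 gen 2, OWNERS row T-N10R / Q6 register, per-row consumers)

HONEST FRAMING (cell `b2b-bsdres`, run/shared/lean/b2b/bsd-rank1-residual/, verbatim in every
file): the goal of the cell is to DELETE the COMBINATION-SHAPED residual classes of the
Birch–Swinnerton-Dyer formula for ALL analytic-rank `≤ 1` elliptic curves over `ℚ` — "full BSD
formula for every rank `≤ 1` curve in class `C`" assembled STRICTLY from published theorems — so
that the rank-`≤ 1` remainder becomes exactly the CONSTRUCTION-SHAPED classes, which are TYPED
(missing-input `Prop`s), NOT attempted. This is not "finishing BSD". Team n1011 (X4 ∧ `p = 3` / the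
additive block, §I items N10 / N11): research routes; census output = EVIDENCE / certificate items,
never a Literature fact; X4♯(G-ord) / X4(M) stay CONSTRUCTION-SHAPED; labels / census / located gap
UNCHANGED; nothing is booked. Theorems only (no definition, no named fact minted).

## What and why

census-ctyper1's `Additive/CensusQ6UnitCoeffCertificate.lean` (p253484) types the PASS(E,p) row of
this seat's register `cells/n1011/PREDICTIONS-Q6.md` §5 as hypothesis instances
`CensusQ6.Gord[Odd]FirstUnitIndexAt W p n₀` / `CensusQ6.Mult[Odd]FirstUnitIndexAt W p n₀` ("the first
`p`-adic unit coefficient of the Néron-normalised `ω^{(p−1)/2}`-branch of `E♭` has index `n₀`") with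
the "record ⟹ binder" lemmas `CensusQ6.gord[Odd]BranchUnitCoeffCert_of_firstUnitIndex` /
`mult[Odd]BranchUnitCoeffCert_of_firstUnitIndex`, and consumes them through this seat's gen-1
EQUALITY nodes. This file gives the same per-row consumers over the PHASE-4 one-sided nodes
(`ChiBranchRatLowerDvd{Odd,∅,MultOdd}At`, p252762 / p253092 / p253261) — the per-row theorem the
Stage A fold (consumer list v3) cites: for a register row `(E, p)` with a PASS record of index `n₀`,

  `BSD(E,p)` ⟸ [record `…FirstUnitIndexAt W p n₀` — EVIDENCE, the kit job] ∧ [the one-sided rational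
  Skinner–Urban containment on the branch — TYPED, the located gap] ∧ printed facts,

at `p = 3` on the Gord3 rows (X4♯(G-ord)@3 ∧ surj ∧ non-anomalous ∧ non-CM) and the (M)@3 rows
(tower-free), and at the register's larger primes ((G-ord) `p ≡ 3 (4)` ≥ 7, `p ≡ 1 (4)` ≥ 5; (M)
`p ≡ 3 (4)`). The (M)-even rows keep census-ctyper1's consumer over the equality node
(`ChiBranchRatCharEqMultAt`) until the (M)-even one-sided twin is filed. Nothing booked; no mark /
label moved; a record instance is per-pair EVIDENCE, never a class-level statement.

References: Mazur–Tate–Teitelbaum, Invent. Math. 84 (1986) §I.13 [MazurTateTeitelbaum1986Invent];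
K. Kato, Astérisque 295 (2004) Thm. 17.4 (3) [Kato2004Asterisque]; D. Delbourgo, J. Number Theory 95
(2002) Theorem (A), (B) [Delbourgo2002]; D. Delbourgo, Compositio Math. 113 (1998) Prop. 4
[Delbourgo1998]; R. L. Miller, LMS J. Comput. Math. 14 (2011) Def. 1.1 [Miller2011LMS]; census lead
`HOME/census/CELL-PLAN.md` §3 H-9; `cells/n1011/PREDICTIONS-Q6.md` §5 (EVIDENCE).
-/

noncomputable section

open scoped Classical MatrixGroups ModularForm NumberField

open CongruenceSubgroup WeierstrassCurve NumberField Literature.NumberTheory.EllipticCurves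
  Literature.NumberTheory.EllipticCurves.ModularForms
  Literature.NumberTheory.EllipticCurves.Rank1Residual
  Literature.NumberTheory.EllipticCurves.Rank1Residual.Typed
  IsDedekindDomain

namespace Summit.BirchSwinnertonDyer.Rank1Residual.Additive

open AdditivePotMult CensusQ6

variable {W : WeierstrassCurve ℚ} [W.IsElliptic] [W.IsGloballyMinimal] {p : ℕ} [hp : Fact p.Prime]

/-! ### §1 The Gord3 rows (X4♯(G-ord) at `3` ∧ surj(3), non-anomalous, non-CM, `r_an = 0`) -/

/-- **Gord3 register row with a PASS record of index `n₀`: the LOWER half at `3`** ⟸ record +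
`ChiBranchRatLowerDvdOddAt W 3` (+ Kato's half `hKW`, Delbourgo 2002 at `3`, GZK, modularity).
[cite: MazurTateTeitelbaum1986Invent, §I.13] [cite: Delbourgo2002, Theorem (A), (B) (p. 40)]
[cite: Miller2011LMS, Def. 1.1] -/
theorem ClassX4Gord.missingLowerBoundAt_three_rankZero_of_ratLowerDvdOdd_of_firstUnitIndex_of_surj
    [Fact (Nat.Prime 3)]
    (hKW : Wuthrich2014.kato_halfEigenCharIdeal_dvd_cyclotomicPrime_of_surjective)
    (hDel3 : Delbourgo2002.mainTheorem_three)
    (hGZK : rank_eq_analyticRank_of_analyticRank_le_one) (hmod : hasEntireLFunction_rat)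
    (hmodD : nonempty_modularParametrizationData)
    (hX : ClassX4Gord W 3) (hcm : ¬ W.HasCM) (hr : W.analyticRank = 0) (hsurj : Surj W 3)
    (hna : Delbourgo2002.ReductionNonAnomalous W 3) (hE : ChiBranchRatLowerDvdOddAt W 3)
    {n₀ : ℕ} (hrec : GordOddFirstUnitIndexAt W 3 n₀) : MissingLowerBoundAt W 3 :=
  hX.missingLowerBoundAt_three_rankZero_of_ratLowerDvdOdd_of_unitCoeff_of_surj hKW hDel3 hGZK hmod hmodD
    hcm hr hsurj hna hE (fun V _ _ C hV hC _ _ f hf ϖ hϖ =>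
      gordOddBranchUnitCoeffCert_of_firstUnitIndex hrec V C hV (by exact_mod_cast hC) f hf ϖ hϖ)

/-- **Gord3 register row with a PASS record of index `n₀`: `BSD(E,3)`** ⟸ record (EVIDENCE) +
`ChiBranchRatLowerDvdOddAt W 3` (TYPED) + printed facts (`hKW`, `hDel3`, `hDel`, GZK, modularity).
Nothing booked. [cite: MazurTateTeitelbaum1986Invent, §I.13] [cite: Kato2004Asterisque, Thm. 17.4 (3) (p. 273)]
[cite: Delbourgo2002, Theorem (A), (B) (p. 40)] [cite: Delbourgo1998, Prop. 4 (p. 144)] [cite: Miller2011LMS, Def. 1.1] -/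
theorem ClassX4Gord.bsdp_three_rankZero_of_ratLowerDvdOdd_of_firstUnitIndex_of_surj [Fact (Nat.Prime 3)]
    (hKW : Wuthrich2014.kato_halfEigenCharIdeal_dvd_cyclotomicPrime_of_surjective)
    (hDel3 : Delbourgo2002.mainTheorem_three)
    (hDel : Delbourgo1998.prop4_rankZero_pow_dvd_constantCoeff)
    (hGZK : rank_eq_analyticRank_of_analyticRank_le_one) (hmod : hasEntireLFunction_rat)
    (hmodD : nonempty_modularParametrizationData)
    (hX : ClassX4Gord W 3) (hcm : ¬ W.HasCM) (hr : W.analyticRank = 0) (hsurj : Surj W 3)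
    (hna : Delbourgo2002.ReductionNonAnomalous W 3) (hE : ChiBranchRatLowerDvdOddAt W 3)
    {n₀ : ℕ} (hrec : GordOddFirstUnitIndexAt W 3 n₀) : BSDp W 3 :=
  hX.bsdp_three_rankZero_of_ratLowerDvdOdd_of_unitCoeff_of_surj hKW hDel3 hDel hGZK hmod hmodD hcm hr
    hsurj hna hE (fun V _ _ C hV hC _ _ f hf ϖ hϖ =>
      gordOddBranchUnitCoeffCert_of_firstUnitIndex hrec V C hV (by exact_mod_cast hC) f hf ϖ hϖ)

/-! ### §2 The (M) rows at `p ≡ 3 (mod 4)` (X4(M) ∧ surj(p), `r_an = 0`), `p = 3` tower-free -/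

/-- **(M) register row, `p ≡ 3 (mod 4)`, PASS record of index `n₀`: the LOWER half** (EXACT, Delbourgo
1998 Prop. 4 (M) `hDelX`) ⟸ record + `ChiBranchRatLowerDvdMultOddAt W p` (+ Kato's half).
[cite: MazurTateTeitelbaum1986Invent, §I.13] [cite: Delbourgo1998, Prop. 4 (p. 144)] [cite: Miller2011LMS, Def. 1.1] -/
theorem _root_.Summit.BirchSwinnertonDyer.Rank1Residual.AdditivePotMult.ClassX4M.missingLowerBoundAt_rankZero_of_ratLowerDvdMultOdd_of_firstUnitIndex_of_surj
    (hKato : Wuthrich2014.kato_halfEigenCharIdeal_dvd_cyclotomicPrime_of_surjective)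
    (hDelX : Delbourgo1998.prop4_rankZero_constantCoeff_eq_unit_mul_of_potMult)
    (hGZK : rank_eq_analyticRank_of_analyticRank_le_one) (hmod : hasEntireLFunction_rat)
    (hmodD : nonempty_modularParametrizationData)
    (hX : AdditivePotMult.ClassX4M W p) (hp4 : p % 4 = 3) (hr : W.analyticRank = 0) (hsurj : Surj W p)
    (hE : ChiBranchRatLowerDvdMultOddAt W p) {n₀ : ℕ} (hrec : MultOddFirstUnitIndexAt W p n₀) :
    MissingLowerBoundAt W p :=
  hX.missingLowerBoundAt_rankZero_of_ratLowerDvdMultOdd_of_unitCoeff_of_surj hKato hDelX hGZK hmod hmodD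
    hp4 hr hsurj hE (multOddBranchUnitCoeffCert_of_firstUnitIndex hrec)

/-- **(M) register row, `p ≡ 3 (mod 4)`, PASS record of index `n₀`: `BSD(E,p)`** ⟸ record (EVIDENCE) +
`ChiBranchRatLowerDvdMultOddAt W p` (TYPED) + printed facts. Nothing booked.
[cite: MazurTateTeitelbaum1986Invent, §I.13] [cite: Kato2004Asterisque, Thm. 17.4 (3) (p. 273)]
[cite: Delbourgo1998, Prop. 4 (p. 144)] [cite: Miller2011LMS, Def. 1.1] -/
theorem _root_.Summit.BirchSwinnertonDyer.Rank1Residual.AdditivePotMult.ClassX4M.bsdp_rankZero_of_ratLowerDvdMultOdd_of_firstUnitIndex_of_surj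
    (hKato : Wuthrich2014.kato_halfEigenCharIdeal_dvd_cyclotomicPrime_of_surjective)
    (hDelX : Delbourgo1998.prop4_rankZero_constantCoeff_eq_unit_mul_of_potMult)
    (hDel : Delbourgo1998.prop4_rankZero_pow_dvd_constantCoeff)
    (hGZK : rank_eq_analyticRank_of_analyticRank_le_one) (hmod : hasEntireLFunction_rat)
    (hmodD : nonempty_modularParametrizationData)
    (hX : AdditivePotMult.ClassX4M W p) (hp4 : p % 4 = 3) (hr : W.analyticRank = 0) (hsurj : Surj W p)
    (hE : ChiBranchRatLowerDvdMultOddAt W p) {n₀ : ℕ} (hrec : MultOddFirstUnitIndexAt W p n₀) :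
    BSDp W p :=
  hX.bsdp_rankZero_of_ratLowerDvdMultOdd_of_unitCoeff_of_surj hKato hDelX hDel hGZK hmod hmodD hp4 hr
    hsurj hE (multOddBranchUnitCoeffCert_of_firstUnitIndex hrec)

/-- **(M)@3 register row (the (M)@3 share of N11), PASS record of index `n₀`: `BSD(E,3)`, TOWER-FREE**
⟸ record (EVIDENCE) + `ChiBranchRatLowerDvdMultOddAt W 3` (TYPED) + printed facts. Nothing booked.
[cite: MazurTateTeitelbaum1986Invent, §I.13] [cite: Kato2004Asterisque, Thm. 17.4 (3) (p. 273)]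
[cite: Delbourgo1998, Prop. 4 (p. 144)] [cite: Miller2011LMS, Def. 1.1] -/
theorem _root_.Summit.BirchSwinnertonDyer.Rank1Residual.AdditivePotMult.ClassX4M.bsdp_three_rankZero_of_ratLowerDvdMultOdd_of_firstUnitIndex_of_surj
    (hKato : Wuthrich2014.kato_halfEigenCharIdeal_dvd_cyclotomicPrime_of_surjective)
    (hDelX : Delbourgo1998.prop4_rankZero_constantCoeff_eq_unit_mul_of_potMult)
    (hDel : Delbourgo1998.prop4_rankZero_pow_dvd_constantCoeff)
    (hGZK : rank_eq_analyticRank_of_analyticRank_le_one) (hmod : hasEntireLFunction_rat)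
    (hmodD : nonempty_modularParametrizationData)
    (hX : AdditivePotMult.ClassX4M W 3) (hr : W.analyticRank = 0) (hsurj : Surj W 3)
    (hE : ChiBranchRatLowerDvdMultOddAt W 3) {n₀ : ℕ} (hrec : MultOddFirstUnitIndexAt W 3 n₀) :
    BSDp W 3 :=
  hX.bsdp_three_rankZero_of_ratLowerDvdMultOdd_of_unitCoeff_of_surj hKato hDelX hDel hGZK hmod hmodD hr
    hsurj hE (multOddBranchUnitCoeffCert_of_firstUnitIndex hrec)

/-! ### §3 The register's larger primes on (G-ord): `p ≡ 3 (mod 4)`, `p ≥ 7` and `p ≡ 1 (mod 4)`, `p ≥ 5` -/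

/-- **GordTwo-ord register row at `p ≡ 3 (mod 4)`, `p ≥ 7` (surj, non-anomalous, non-CM, `r_an = 0`),
PASS record of index `n₀`: `BSD(E,p)`** ⟸ record + `ChiBranchRatLowerDvdOddAt W p` + printed facts
(Serre's tower at `p ≥ 5`). Nothing booked. [cite: MazurTateTeitelbaum1986Invent, §I.13]
[cite: Kato2004Asterisque, Thm. 17.4 (3) (p. 273)] [cite: Delbourgo2002, Theorem (A), (B) (p. 40)]
[cite: Miller2011LMS, Def. 1.1] -/
theorem ClassX4Gord.bsdp_rankZero_of_ratLowerDvdOdd_of_firstUnitIndex_of_surj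
    (hKW : Wuthrich2014.kato_halfEigenCharIdeal_dvd_cyclotomicPrime_of_surjective)
    (hDel : Delbourgo2002.mainTheorem)
    (hDel98 : Delbourgo1998.prop4_rankZero_pow_dvd_constantCoeff)
    (hGZK : rank_eq_analyticRank_of_analyticRank_le_one) (hmod : hasEntireLFunction_rat)
    (hmodD : nonempty_modularParametrizationData)
    (hX : ClassX4Gord W p) (he : semistabilityIndex W p = 2) (hp5 : 5 ≤ p) (hp4 : p % 4 = 3)
    (hcm : ¬ W.HasCM) (hr : W.analyticRank = 0) (hna : Delbourgo2002.ReductionNonAnomalous W p)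
    (hsurj : Surj W p) (hE : ChiBranchRatLowerDvdOddAt W p)
    {n₀ : ℕ} (hrec : GordOddFirstUnitIndexAt W p n₀) : BSDp W p :=
  ClassX4Gord.bsdp_rankZero_of_ratLowerDvdOdd_of_unitCoeff_of_surj hKW hDel hDel98 hGZK hmod hmodD hX he
    hp5 hp4 hcm hr hna hsurj hE (gordOddBranchUnitCoeffCert_of_firstUnitIndex hrec)

/-- **GordTwo-ord register row at `p ≡ 1 (mod 4)`, `p ≥ 5` (surj, non-anomalous, non-CM, `r_an = 0`),
PASS record of index `n₀`: `BSD(E,p)`** ⟸ record + `ChiBranchRatLowerDvdAt W p` (even node) + printed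
facts (Pal `hPal`, Serre's tower). Nothing booked. [cite: MazurTateTeitelbaum1986Invent, §I.13]
[cite: Kato2004Asterisque, Thm. 17.4 (3) (p. 273)] [cite: Delbourgo2002, Theorem (A), (B) (p. 40)]
[cite: Pal2012, Thm. 3.2] [cite: Miller2011LMS, Def. 1.1] -/
theorem ClassX4Gord.bsdp_rankZero_of_ratLowerDvd_of_firstUnitIndex_of_surj
    (hKW : Wuthrich2014.kato_halfEigenCharIdeal_dvd_cyclotomicPrime_of_surjective)
    (hDel : Delbourgo2002.mainTheorem)
    (hDel98 : Delbourgo1998.prop4_rankZero_pow_dvd_constantCoeff)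
    (hPal : Pal2012.thm32_sqrt_mul_realPeriodRat_twist_eq_of_prime_one_mod_four)
    (hGZK : rank_eq_analyticRank_of_analyticRank_le_one) (hmod : hasEntireLFunction_rat)
    (hmodD : nonempty_modularParametrizationData)
    (hX : ClassX4Gord W p) (he : semistabilityIndex W p = 2) (hp5 : 5 ≤ p) (hp4 : p % 4 = 1)
    (hcm : ¬ W.HasCM) (hr : W.analyticRank = 0) (hna : Delbourgo2002.ReductionNonAnomalous W p)
    (hsurj : Surj W p) (hE : ChiBranchRatLowerDvdAt W p)
    {n₀ : ℕ} (hrec : GordFirstUnitIndexAt W p n₀) : BSDp W p :=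
  ClassX4Gord.bsdp_rankZero_of_ratLowerDvd_of_unitCoeff_of_surj hKW hDel hDel98 hPal hGZK hmod hmodD hX he
    hp5 hp4 hcm hr hna hsurj hE (gordBranchUnitCoeffCert_of_firstUnitIndex hrec)

end Summit.BirchSwinnertonDyer.Rank1Residual.Additive

end
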